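import Summits.BirchSwinnertonDyer.BirchSwinnertonDyer.Theorems.PrintCf2SplitBadTwoStrictDefectClassThreeReader
import Summits.BirchSwinnertonDyer.BirchSwinnertonDyer.Theorems.PrintCf2SplitBadTwoStrictDefectClassThreeEmbedding
import Summits.BirchSwinnertonDyer.BirchSwinnertonDyer.Theorems.PrintCf2SplitBadTwoLocalDefectClassThree
import Summits.BirchSwinnertonDyer.BirchSwinnertonDyer.Theorems.PrintCf2SplitBadTwoUnrLocalDefectFrame
import Summits.BirchSwinnertonDyer.BirchSwinnertonDyer.Theorems.PrintCf2SplitBadTwoUnrNotStrictOfFrameClassThree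
import HarnessLib

/-!
# Crux `PrintCf2.SplitBadTwoRankOneOfFacts` (stmt-BirchSwinnertonDyer-20368), skeleton v13.1, stub S3d `stub_strictDefectAtVbar_two`
# (= route-C item 24036 `StrictDefectAtVbarTwo`) — class (iii) OF S3d ON THE FRAME, EVERY DISPLAYED INPUT DISCHARGED:
# `n' = n + 2` on `d ≡ 3 (8)`, `n' = n + 1` on `d ≡ 14 (16)` (the hypotheses `h13` / `h07` of the S3d assembly, as theorems)

Cell `bsd-print-cf2`, EXTRA WIDTH seat `bsd-line-cf2-p1-w3` g12 (prover-bsd-line-cf2-p1-w3-g12-0); `--supports stmt-BirchSwinnertonDyer-20368`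
(helper, Theses-free). HONEST FRAMING: nothing here closes the crux or the registered stub S3d; BSD is not proved by any of this; no summit
statement is proved by this seat. No definition, no named fact, no `sorry`. Assembly of this seat's reader `…StrictDefectClassThreeReader` (p696679, receptacle `H := W*`) and
generic embedding `…StrictDefectClassThreeEmbedding` (`exists_equivariant_injective_eval`, `j := eval_{φ₀} ∘ (DC-6)`) with the frame theorems of
-w8 g4 (`LineDoubleCoset.kerD_inputs_of_frame`, p694414), -w6 g5 D2 (p695750), -w4 g11 (p695592) and -w7 g5 (p695439).

* (road-α frames, class (iii), S3d-BODY SHAPE): **`strictDefectAtVbar_two_of_frame_three`** (`d ≡ 3 (8)`, `(n' : ℤ) = n + 2`) and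
  **`strictDefectAtVbar_two_of_frame_even_seven`** (`d ≡ 14 (16)`, `(n' : ℤ) = n + 1`) — EXACTLY the hypotheses `h13` / `h07` of -w6 g5's assembly
  `StrictDefect.strictDefectAtVbar_two_of_classes` (p696075), every displayed input DISCHARGED: the reader `…StrictDefectClassThreeReader` (receptacle
  `H := W*`, this seat p695516), `j` from `exists_equivariant_injective_eval` on `LineDoubleCoset.kerD_inputs_of_frame` (-w8 g4) and -w6 g5's D2 frame data
  (`LocalDefectTrivial.exists_kerD_eq_absGaloisRestrict_of_frame`, `smul_eq_self_kerD_of_frame_classThree`), `(S_{W*}(K'_∞))_Γ = 0` = -w4 g11's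
  `UnrBaseLift.natCard_endCoinvariants_conjUnr_eq_one_of_frame_classThree` (p695592), `𝔖 ≠ S_{W*}(K'_∞)` = -w7 g5's
  `StrictDefectInfinite.restrictedSelmerZp_addSubgroupOf_unrSelmer_ne_top_of_frame_classThree'` (p695439), and the Agboola datum
  `D := Agboola2007.restrictedDualData` (the character group of `𝔖` itself). With -w8 g4's class (i) (p695861) the registered stub S3d is then
  `strictDefectAtVbar_two_of_classes strictDefectAtVbar_two_of_frame_three strictDefectAtVbar_two_of_frame_even_seven <class (i)>` (assembler -w6 g5).

presearch: Greenberg–Vatsal 2000 §2 pp. 17, 20–21 (Cor. 2.3: `S^{Σ₀}/S ≅ ∏ 𝓗_ℓ`, `𝓗_ℓ = H¹_nr/H¹_str ≅ W*` via evaluation at Frobenius); Agboola 2007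
§3 Prop. 3.2 — held; tree assembly, no new fact. beyond-print theorem: no.

References: [GreenbergVatsal2000] §2 Prop. 2.1, Cor. 2.3, Prop. 2.4 (pp. 17–22); [Agboola2007] §3 Prop. 3.2, §5; [SerreGaloisCohomology1997] I §2.3, §2.5;
[GreenbergLNM1716] §4 Lemma 4.2.
-/

noncomputable section

open scoped Classical

-- the summit namespace `Summit.BirchSwinnertonDyer.BirchSwinnertonDyer` repeats the problem name by design (D-0017)
set_option linter.dupNamespace false
set_option autoImplicit false

open NumberField IsDedekindDomain Field
open Literature.NumberTheory.EllipticCurves Literature.NumberTheory.EllipticCurves.GreenbergSelmer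
open Literature.NumberTheory.EllipticCurves.GreenbergVatsal2000 Literature.NumberTheory.EllipticCurves.KellerYin2024
open Literature.NumberTheory.EllipticCurves.Agboola2007
open Literature.NumberTheory.EllipticCurves.IwasawaAlgebra Literature.NumberTheory.EllipticCurves.IwasawaDual
open Literature.NumberTheory.GaloisRepresentations
open Summit.BirchSwinnertonDyer.Rank1Residual.X11b

namespace Summit.BirchSwinnertonDyer.BirchSwinnertonDyer.Theorems.PrintCf2.StrictDefect

/-! ## Road-α frames, class (iii): S3d's body with `e_δ = 2` (`d ≡ 3 (8)`) and `e_δ = 1` (`d ≡ 14 (16)`), NO displayed hypothesis -/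

section Frame

open WeierstrassCurve
open Summit.BirchSwinnertonDyer.BirchSwinnertonDyer.Theorems.PrintCf2.RestrictedSelmerPair

/-- **S3d ON CLASS (iii), `d ≡ 3 (mod 8)`: `n' = n + 2`** — the hypothesis `h13` of -w6 g5's `strictDefectAtVbar_two_of_classes`, VERBATIM, as a theorem.
For every road-α frame of S3d (member `C • W = cm7^{(d)}` of analytic rank one with `Ш(W)` finite, `K` imaginary quadratic, `2 = v v̄`, `π² = π − 2`,
`r² = r − 2`, pinning clause at `v`, line `κ'` unramified outside `v̄` with generator `γ'`, `ℚ`-generator datum `P, c₀, ℓ`) and every Greenberg–Vatsal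
datum `Dnr` of `S_{W*}(K'_∞)` (finitely generated torsion, `char = (H')`, `H'(0) ≠ 0` of valuation `n'`): the Agboola datum `D = Hom(𝔖_{v̄}(K'_∞, W*), ℚ/ℤ)`
is finitely generated with `D.HasCharValuationAt n` and `n' = n + 2`. Proof: reader `valuation_eq_add_two_of_frame_three` (receptacle `W*`: `#W*^{D_v̄} = 4`,
`W*_{δ} = 0`, `W*` cocyclic) ∘ `exists_equivariant_injective_eval` (`j = eval_{φ₀} ∘ res_{D″}`) ∘ -w6 g5 D2 (`σ₀`, `φ₀`, `D″`-triviality) ∘ -w4 g11 (`(S_nr)_Γ = 0`) ∘ -w7 g5 (`𝔖 ≠ S_nr`).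
[cite: GreenbergVatsal2000, §2 Cor. 2.3, Prop. 2.4 (pp. 20–22)] [cite: Agboola2007, §3 Prop. 3.2, Thm. 3.1, §5] [cite: GreenbergLNM1716, §4 Lemma 4.2] -/
theorem strictDefectAtVbar_two_of_frame_three :
    ∀ (d : ℤ), d ≠ 0 → Squarefree d → d % 4 ≠ 1 → d % 8 = 3 →
      ∀ (W : WeierstrassCurve ℚ) [W.IsElliptic] [W.IsGloballyMinimal] (C : VariableChange ℚ),
        C • W = cm7.quadraticTwist (d : ℚ) → W.analyticRank = 1 → Finite W.sha →
      ∀ (K : Type) [Field K] [NumberField K], IsImaginaryQuadratic K →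
      ∀ (v vbar : HeightOneSpectrum (𝓞 K)),
        ((2 : ℕ) : 𝓞 K) ∈ v.asIdeal → ((2 : ℕ) : 𝓞 K) ∈ vbar.asIdeal → vbar ≠ v →
      ∀ (π : (W.baseChange K).endRing), (π : AddMonoid.End (W.baseChange K).geomPoints) * π = π - 2 →
      ∀ (r : ℤ_[2]), r * r = r - 2 →
        (∀ τ ∈ GreenbergSelmer.inertia v, ∀ x : ↥((W.baseChange K).endEigenPrimaryTorsion 2 π r), τ • x = x ∨ τ • x = -x) →
      ∀ (κ' : ZpExtension K 2), κ'.IsUnramifiedOutside vbar → ∀ (γ' : absoluteGaloisGroup K), κ'.IsTopGenerator γ' →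
      ∀ (P : W.toAffine.Point) (c₀ : ℕ) (ℓ : ℤ),
        ¬ IsOfFinAddOrder P →
        (∀ R : W.toAffine.Point, ∃ (k : ℤ) (T : W.toAffine.Point), IsOfFinAddOrder T ∧ R = k • P + T) →
        c₀ ≠ 0 → (W.baseChange ℚ_[2]).IsInReductionKernel (c₀ • W.toPadicPoint 2 P) →
        ‖(W.baseChange ℚ_[2]).padicLogPoint (c₀ • W.toPadicPoint 2 P) / (c₀ : ℚ_[2])‖ = (2 : ℝ) ^ (-ℓ) →
      ∀ (Dnr : GreenbergVatsal2000.DatumDualData κ' γ' ↥((W.baseChange K).endEigenPrimaryTorsion 2 π r)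
          (Castella2018.AcSelmer.bdpData ↥((W.baseChange K).endEigenPrimaryTorsion 2 π r) 2 vbar) ∅) (n' : ℕ) (H' : IwasawaAlgebra 2),
        Module.Finite (IwasawaAlgebra 2) Dnr.X → Module.IsTorsion (IwasawaAlgebra 2) Dnr.X →
        Module.charIdeal (IwasawaAlgebra 2) Dnr.X = Ideal.span {H'} → PowerSeries.constantCoeff H' ≠ 0 →
        (PowerSeries.constantCoeff H').valuation = n' →
      ∃ (D : Agboola2007.RestrictedDualData κ' ↥((W.baseChange K).endEigenPrimaryTorsion 2 π r) vbar γ') (n : ℕ),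
        Module.Finite (IwasawaAlgebra 2) D.X ∧ D.HasCharValuationAt n ∧ (n' : ℤ) = n + 2 := by
  intro d hd0 hsq hd4 hd8 W _ _ C hC hrank hsha K _ _ hK v vbar hv hvbar hne π hπ r hr hpin κ' hκ' γ' hγ' P c₀ ℓ hP hgen hc₀ hker hlog
    Dnr n' H' hfin htors hch hH0 hn'
  haveI := hfin
  obtain ⟨hTC, ⟨τ₁, hτ₁, hu⟩, haway⟩ := LineDoubleCoset.kerD_inputs_of_frame hd0 W C hC hK hv hvbar hne π hπ r κ' hκ'
  haveI : IsTotallyComplex K := hTC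
  obtain ⟨σ₀, φ₀, hσ₀, hφ₀⟩ :=
    LocalDefectTrivial.exists_kerD_eq_absGaloisRestrict_of_frame hd0 W C hC hK v vbar hv hvbar hne π hπ hr hpin κ' hκ'
  obtain ⟨δ, hδD, -, hδγ, j, hj, hje⟩ := exists_equivariant_injective_eval κ' ↥((W.baseChange K).endEigenPrimaryTorsion 2 π r) vbar hvbar
    haway hτ₁ hu γ' (LocalDefectTrivial.smul_eq_self_kerD_of_frame_classThree hd0 (Or.inl hd8) W C hC hK v vbar hv hvbar hne π hπ hr hpin κ' hκ')
    hσ₀ hφ₀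
  obtain ⟨hDfin, n, hDn, hval⟩ := valuation_eq_add_two_of_frame_three hd0 hd8 W C hC hK v vbar hv hvbar hne π hπ hr hpin κ' hκ' hγ' hδD hδγ
    Dnr htors hch hH0
    (Agboola2007.restrictedDualData κ' vbar (exists_pow_smul_endEigenPrimaryTorsion_eq_zero (W.baseChange K) 2 π r)
      (isOpen_stabilizer_endEigenPrimaryTorsion (W.baseChange K) 2 π r) hγ')
    j hj hje
    (UnrBaseLift.natCard_endCoinvariants_conjUnr_eq_one_of_frame_classThree hd0 hsq hd4 (Or.inl hd8) W C hC hrank hsha hK hv hvbar hne π hπ hr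
      hpin κ' hκ' hγ' P c₀ ℓ hP hgen hc₀ hker hlog)
    (StrictDefectInfinite.restrictedSelmerZp_addSubgroupOf_unrSelmer_ne_top_of_frame_classThree' hd0 hsq hd4 (Or.inl hd8) W C hC hrank hsha hK
      v vbar hv hvbar hne π hπ r hr hpin κ' hκ' P c₀ ℓ hP hgen hc₀ hker hlog)
  have hn : n' = n + 2 := hn'.symm.trans hval
  exact ⟨_, n, hDfin, hDn, by omega⟩

/-- **S3d ON CLASS (iii), `d ≡ 14 (mod 16)`: `n' = n + 1`** — the hypothesis `h07` of -w6 g5's `strictDefectAtVbar_two_of_classes`, VERBATIM, as a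
theorem (as `strictDefectAtVbar_two_of_frame_three`, through `valuation_eq_add_one_of_frame_even_seven`: `#W*^{D_v̄} = 2`).
[cite: GreenbergVatsal2000, §2 Cor. 2.3, Prop. 2.4 (pp. 20–22)] [cite: Agboola2007, §3 Prop. 3.2, Thm. 3.1, §5] [cite: GreenbergLNM1716, §4 Lemma 4.2] -/
theorem strictDefectAtVbar_two_of_frame_even_seven :
    ∀ (d : ℤ), d ≠ 0 → Squarefree d → d % 4 ≠ 1 → ((2 : ℤ) ∣ d ∧ (d / 2) % 8 = 7) →
      ∀ (W : WeierstrassCurve ℚ) [W.IsElliptic] [W.IsGloballyMinimal] (C : VariableChange ℚ),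
        C • W = cm7.quadraticTwist (d : ℚ) → W.analyticRank = 1 → Finite W.sha →
      ∀ (K : Type) [Field K] [NumberField K], IsImaginaryQuadratic K →
      ∀ (v vbar : HeightOneSpectrum (𝓞 K)),
        ((2 : ℕ) : 𝓞 K) ∈ v.asIdeal → ((2 : ℕ) : 𝓞 K) ∈ vbar.asIdeal → vbar ≠ v →
      ∀ (π : (W.baseChange K).endRing), (π : AddMonoid.End (W.baseChange K).geomPoints) * π = π - 2 →
      ∀ (r : ℤ_[2]), r * r = r - 2 →
        (∀ τ ∈ GreenbergSelmer.inertia v, ∀ x : ↥((W.baseChange K).endEigenPrimaryTorsion 2 π r), τ • x = x ∨ τ • x = -x) →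
      ∀ (κ' : ZpExtension K 2), κ'.IsUnramifiedOutside vbar → ∀ (γ' : absoluteGaloisGroup K), κ'.IsTopGenerator γ' →
      ∀ (P : W.toAffine.Point) (c₀ : ℕ) (ℓ : ℤ),
        ¬ IsOfFinAddOrder P →
        (∀ R : W.toAffine.Point, ∃ (k : ℤ) (T : W.toAffine.Point), IsOfFinAddOrder T ∧ R = k • P + T) →
        c₀ ≠ 0 → (W.baseChange ℚ_[2]).IsInReductionKernel (c₀ • W.toPadicPoint 2 P) →
        ‖(W.baseChange ℚ_[2]).padicLogPoint (c₀ • W.toPadicPoint 2 P) / (c₀ : ℚ_[2])‖ = (2 : ℝ) ^ (-ℓ) →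
      ∀ (Dnr : GreenbergVatsal2000.DatumDualData κ' γ' ↥((W.baseChange K).endEigenPrimaryTorsion 2 π r)
          (Castella2018.AcSelmer.bdpData ↥((W.baseChange K).endEigenPrimaryTorsion 2 π r) 2 vbar) ∅) (n' : ℕ) (H' : IwasawaAlgebra 2),
        Module.Finite (IwasawaAlgebra 2) Dnr.X → Module.IsTorsion (IwasawaAlgebra 2) Dnr.X →
        Module.charIdeal (IwasawaAlgebra 2) Dnr.X = Ideal.span {H'} → PowerSeries.constantCoeff H' ≠ 0 →
        (PowerSeries.constantCoeff H').valuation = n' →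
      ∃ (D : Agboola2007.RestrictedDualData κ' ↥((W.baseChange K).endEigenPrimaryTorsion 2 π r) vbar γ') (n : ℕ),
        Module.Finite (IwasawaAlgebra 2) D.X ∧ D.HasCharValuationAt n ∧ (n' : ℤ) = n + 1 := by
  intro d hd0 hsq hd4 hcl W _ _ C hC hrank hsha K _ _ hK v vbar hv hvbar hne π hπ r hr hpin κ' hκ' γ' hγ' P c₀ ℓ hP hgen hc₀ hker hlog
    Dnr n' H' hfin htors hch hH0 hn'
  haveI := hfin
  obtain ⟨hTC, ⟨τ₁, hτ₁, hu⟩, haway⟩ := LineDoubleCoset.kerD_inputs_of_frame hd0 W C hC hK hv hvbar hne π hπ r κ' hκ'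
  haveI : IsTotallyComplex K := hTC
  obtain ⟨σ₀, φ₀, hσ₀, hφ₀⟩ :=
    LocalDefectTrivial.exists_kerD_eq_absGaloisRestrict_of_frame hd0 W C hC hK v vbar hv hvbar hne π hπ hr hpin κ' hκ'
  obtain ⟨δ, hδD, -, hδγ, j, hj, hje⟩ := exists_equivariant_injective_eval κ' ↥((W.baseChange K).endEigenPrimaryTorsion 2 π r) vbar hvbar
    haway hτ₁ hu γ' (LocalDefectTrivial.smul_eq_self_kerD_of_frame_classThree hd0 (Or.inr hcl) W C hC hK v vbar hv hvbar hne π hπ hr hpin κ' hκ')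
    hσ₀ hφ₀
  obtain ⟨hDfin, n, hDn, hval⟩ := valuation_eq_add_one_of_frame_even_seven hd0 hsq hcl.1 hcl.2 W C hC hK v vbar hv hvbar hne π hπ hr hpin κ' hκ'
    hγ' hδD hδγ Dnr htors hch hH0
    (Agboola2007.restrictedDualData κ' vbar (exists_pow_smul_endEigenPrimaryTorsion_eq_zero (W.baseChange K) 2 π r)
      (isOpen_stabilizer_endEigenPrimaryTorsion (W.baseChange K) 2 π r) hγ')
    j hj hje
    (UnrBaseLift.natCard_endCoinvariants_conjUnr_eq_one_of_frame_classThree hd0 hsq hd4 (Or.inr hcl) W C hC hrank hsha hK hv hvbar hne π hπ hr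
      hpin κ' hκ' hγ' P c₀ ℓ hP hgen hc₀ hker hlog)
    (StrictDefectInfinite.restrictedSelmerZp_addSubgroupOf_unrSelmer_ne_top_of_frame_classThree' hd0 hsq hd4 (Or.inr hcl) W C hC hrank hsha hK
      v vbar hv hvbar hne π hπ r hr hpin κ' hκ' P c₀ ℓ hP hgen hc₀ hker hlog)
  have hn : n' = n + 1 := hn'.symm.trans hval
  exact ⟨_, n, hDfin, hDn, by omega⟩

end Frame

end Summit.BirchSwinnertonDyer.BirchSwinnertonDyer.Theorems.PrintCf2.StrictDefect

end
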